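import Mathlib
import Summits.RiemannHypothesis.RiemannHypothesis.Theorems.IntegerScrewExitGreen
import HarnessLib

/-!
# Route `IntegerScrew` — the Green function of the exit-death chain, SHARP form:
# `|Γ(x) − log R/log x| ≤ κ·log R/log²x` with NO restriction on the window (CONTINUUM-LIMIT §26.1)

`IntegerScrewExitGreen.exitGamma_le` / `IntegerScrewExitGreenLower.le_exitGamma` bound the Green function
`Γ = exitGamma R Q` of the exit-death chain (CONTINUUM-LIMIT §25.1) by `A·log R/log x` and `B·log R/log x` with
CONSTANTS `A, B`; the induction with a constant potential forces `A − 1, 1 − B ≍ log R/log²(Q+1)` and hence the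
hypothesis `log²(Q+1) ≳ log R` («the bottom is not too thin»).  The continuum deviation equation
`D(s) ≤ e(s) + ∫_s^L D(s′)ds′/s′` with `e(s) ≍ log R/s²` has the solution `D ≍ log R/s²` — a RELATIVE error
`O(1/log x)`, uniformly in the window.  This file runs the induction with the `s`-dependent potential
`(1 ± κ/log x)·log R/log x` and obtains exactly that, for EVERY window `Q < x ≤ R` with `Q ≥ Q₀(κ)` an absolute
constant:

* `integral_inv_cube_shift` — `∫₀^T B/(s+t)³ dt = (B/2)(1/s² − 1/(s+T)²)`;
* `sum_vonMangoldt_div_mul_inv_cube_le` — `Σ_{n≤N}(Λ(n)/n)·B/(s+log n)³ ≤ (39/50)B/s³ + (B/2)(1/s² − 1/(s+log N)²)`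
  (the Abel step of `IntegerScrewChebyshevAbel` for the cube);
* **`exitGamma_le_sharp`** — if `κ ≥ 0` and `(39/25)(1 + κ/log(Q+1)) ≤ κ` then
  `Γ(x) ≤ log R/log x + κ·log R/log²x` on the window (e.g. `κ = 4` for `Q ≥ 12`);
* `exitGamma_le_sharp'` — the constant form `Γ ≤ (1 + κ/log(Q+1))·log R/log x`, which feeds the
  pointwise-hypothesis versions of THEOREM A's chain; the lower half `log R/log x − κ′·log R/log²x ≤ Γ(x)` is
  `IntegerScrewExitGreenSharpLower.le_exitGamma_sharp`.

Consequence (CONTINUUM-LIMIT §26): THEOREM A holds for ALL windows `2Q ≤ R`, `Q ≥ Q₀`, with residual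
`κ_res = O((log R/log Q)²)` instead of `O((log R/log Q)⁴)` — what the pricing of THEOREM B's tilt needs.
RH-free, elementary.  Nothing in this file bears on the truth of RH.
References: CONTINUUM-LIMIT §25.3, §26.1 (rh-explicit A6-PIVOT); M. Suzuki, J. Lond. Math. Soc. (2) 108 (2023)
1448–1487 [Suzuki2023] for the screw matrices this serves.
-/

noncomputable section

set_option linter.dupNamespace false -- D-0017: `Summit.<S>.<S>.…` is the designed namespace

namespace Summit.RiemannHypothesis.RiemannHypothesis.Theorems.IntegerScrew

open Finset Real
open ArithmeticFunction (vonMangoldt)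

/-! ### The cube instance of the Abel step -/

/-- `∫₀^T B/(s+t)³ dt = (B/2)(1/s² − 1/(s+T)²)` for `s > 0`, `T ≥ 0`. -/
theorem integral_inv_cube_shift {s T B : ℝ} (hs : 0 < s) (hT : 0 ≤ T) :
    ∫ t in (0 : ℝ)..T, B / (s + t) ^ 3 = B / 2 * (1 / s ^ 2 - 1 / (s + T) ^ 2) := by
  have hderiv : ∀ t ∈ Set.uIcc 0 T, HasDerivAt (fun t => -(B / 2) / (s + t) ^ 2) (B / (s + t) ^ 3) t := by
    intro t ht
    rw [Set.uIcc_of_le hT] at ht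
    have hst : s + t ≠ 0 := by linarith [ht.1]
    have h1 : HasDerivAt (fun y : ℝ => s + y) 1 t := (hasDerivAt_id t).const_add s
    have h2 : HasDerivAt (fun y : ℝ => (s + y)⁻¹ * (s + y)⁻¹)
        (-1 / (s + t) ^ 2 * (s + t)⁻¹ + (s + t)⁻¹ * (-1 / (s + t) ^ 2)) t := (h1.inv hst).mul (h1.inv hst)
    have h3 := h2.const_mul (-(B / 2))
    have hfun : (fun y : ℝ => -(B / 2) / (s + y) ^ 2) = fun y => -(B / 2) * ((s + y)⁻¹ * (s + y)⁻¹) := by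
      funext y
      rw [div_eq_mul_inv, ← mul_inv, sq]
    have hval : -(B / 2) * (-1 / (s + t) ^ 2 * (s + t)⁻¹ + (s + t)⁻¹ * (-1 / (s + t) ^ 2)) =
        B / (s + t) ^ 3 := by
      field_simp
      ring
    rw [hfun, ← hval]
    exact h3
  have hcont : ContinuousOn (fun t => B / (s + t) ^ 3) (Set.uIcc 0 T) := by
    refine ContinuousOn.div continuousOn_const (by fun_prop) ?_
    intro t ht
    rw [Set.uIcc_of_le hT] at ht
    have : 0 < s + t := by linarith [ht.1]
    positivity
  rw [intervalIntegral.integral_eq_sub_of_hasDerivAt hderiv (hcont.intervalIntegrable)]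
  have h0 : s + 0 ≠ 0 := by linarith
  have h1 : s + T ≠ 0 := by linarith
  field_simp
  ring

/-- The cube instance of the Abel step: for `s > 0`, `B ≥ 0`, `N ≥ 1`,
`Σ_{n ≤ N} (Λ(n)/n)·B/(s + log n)³ ≤ (39/50)·B/s³ + (B/2)·(1/s² − 1/(s + log N)²)`. -/
theorem sum_vonMangoldt_div_mul_inv_cube_le {N : ℕ} (hN : 1 ≤ N) {s B : ℝ} (hs : 0 < s) (hB : 0 ≤ B) :
    ∑ n ∈ Icc 1 N, vonMangoldt n / n * (B / (s + Real.log n) ^ 3) ≤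
      39 / 50 * (B / s ^ 3) + B / 2 * (1 / s ^ 2 - 1 / (s + Real.log N) ^ 2) := by
  have hlogN : 0 ≤ Real.log N := Real.log_natCast_nonneg N
  set f : ℝ → ℝ := fun t => B / (s + t) ^ 3 with hf
  have hanti : AntitoneOn f (Set.Icc 0 (Real.log N)) := by
    intro x hx y hy hxy
    simp only [hf]
    have hx0 : 0 < s + x := by linarith [hx.1]
    exact div_le_div_of_nonneg_left hB (by positivity)
      (pow_le_pow_left₀ hx0.le (by linarith) 3)
  have hnn : ∀ t ∈ Set.Icc 0 (Real.log N), 0 ≤ f t := fun t ht => by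
    simp only [hf]
    have : 0 < s + t := by linarith [ht.1]
    positivity
  have h := sum_vonMangoldt_div_mul_comp_log_le_integral hN hanti hnn
  simp only [hf, add_zero] at h
  rw [integral_inv_cube_shift hs hlogN] at h
  exact h

/-! ### The Green function from above, sharp form -/

/-- **`Γ(x) ≤ log R/log x + κ·log R/log²x` (CONTINUUM-LIMIT §26.1, upper half).**  Let `1 ≤ Q`, `0 ≤ κ` and
`(39/25)·(1 + κ/log(Q+1)) ≤ κ`.  Then for every `Q < x ≤ R`: `Γ(x) ≤ log R/log x + κ log R/log²x`.
Proof: downward induction with the potential `L/s + κL/s²` (`s = log x`, `L = log R`): by the induction hypothesis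
and the two Abel steps (`sum_vonMangoldt_div_mul_inv_sq_le`, `sum_vonMangoldt_div_mul_inv_cube_le`),
`Γ(x) ≤ 1 + [(39/50)L/s² + L(1/s − 1/y)] + [(39/50)κL/s³ + (κL/2)(1/s² − 1/y²)]` with `y = log x + log⌊R/x⌋ ≤ L`,
and `(39/50)(1 + κ/s) ≤ κ/2` closes the step. -/
theorem exitGamma_le_sharp {R Q : ℕ} (hQ : 1 ≤ Q) {κ : ℝ} (hκ : 0 ≤ κ)
    (hQκ : 39 / 25 * (1 + κ / Real.log ((Q : ℝ) + 1)) ≤ κ) :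
    ∀ x, Q < x → x ≤ R →
      exitGamma R Q x ≤ Real.log R / Real.log x + κ * Real.log R / Real.log x ^ 2 := by
  suffices H : ∀ k x, R + 1 - x = k → Q < x → x ≤ R →
      exitGamma R Q x ≤ Real.log R / Real.log x + κ * Real.log R / Real.log x ^ 2 from
    fun x hQx hxR => H _ x rfl hQx hxR
  intro k
  induction k using Nat.strong_induction_on with
  | _ k ih =>
    intro x hk hQx hxR
    have hx2 : (2 : ℝ) ≤ x := by exact_mod_cast (show 2 ≤ x by omega)
    have hxR' : (x : ℝ) ≤ R := by exact_mod_cast hxR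
    have hlogx : 0 < Real.log x := Real.log_pos (by linarith)
    have hlogQ1 : Real.log ((Q : ℝ) + 1) ≤ Real.log x :=
      Real.log_le_log (by positivity) (by exact_mod_cast hQx)
    have hlogQ1pos : 0 < Real.log ((Q : ℝ) + 1) := Real.log_pos (by
      have : (1 : ℝ) ≤ Q := by exact_mod_cast hQ
      linarith)
    have hL : Real.log x ≤ Real.log R := Real.log_le_log (by linarith) hxR'
    have hLnn : 0 ≤ Real.log R := hlogx.le.trans hL
    set L := Real.log R with hLdef
    set s := Real.log x with hs
    rw [exitGamma_eq ⟨hQx, hxR⟩]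
    -- Step 1: the induction hypothesis inside the sum
    have hsum : ∑ n ∈ Icc 2 (R / x), vonMangoldt n / n * (exitGamma R Q (x * n) / Real.log ((x * n : ℕ) : ℝ)) ≤
        ∑ n ∈ Icc 2 (R / x), vonMangoldt n / n *
          (L / (s + Real.log n) ^ 2 + κ * L / (s + Real.log n) ^ 3) := by
      refine Finset.sum_le_sum fun n hn => ?_
      have hn' := Finset.mem_Icc.1 hn
      have hxn : x * n ≤ R := by
        have := (Nat.le_div_iff_mul_le (by omega)).1 hn'.2
        rwa [mul_comm] at this
      have hlt : x < x * n := by nlinarith [hn'.1]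
      have hQxn : Q < x * n := lt_trans hQx hlt
      have hG := ih (R + 1 - x * n) (by omega) (x * n) rfl hQxn hxn
      have hn2 : (2 : ℝ) ≤ n := by exact_mod_cast hn'.1
      have hlogn : 0 < Real.log n := Real.log_pos (by linarith)
      have hlogxn : Real.log ((x * n : ℕ) : ℝ) = s + Real.log n := by
        push_cast
        rw [Real.log_mul (by positivity) (by positivity)]
      refine mul_le_mul_of_nonneg_left ?_ (div_nonneg ArithmeticFunction.vonMangoldt_nonneg (Nat.cast_nonneg _))
      rw [hlogxn] at hG ⊢
      have hpos : 0 < s + Real.log n := by linarith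
      calc exitGamma R Q (x * n) / (s + Real.log n)
          ≤ (L / (s + Real.log n) + κ * L / (s + Real.log n) ^ 2) / (s + Real.log n) :=
            div_le_div_of_nonneg_right hG hpos.le
        _ = L / (s + Real.log n) ^ 2 + κ * L / (s + Real.log n) ^ 3 := by
            field_simp
    -- Step 2: the two Abel steps
    have hRx : 1 ≤ R / x := Nat.div_pos hxR (by omega)
    have hκL : 0 ≤ κ * L := mul_nonneg hκ hLnn
    have habel1 := sum_vonMangoldt_div_mul_inv_sq_le (N := R / x) hRx hlogx hLnn
    have habel2 := sum_vonMangoldt_div_mul_inv_cube_le (N := R / x) hRx hlogx hκL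
    -- Icc 1 N ⊇ Icc 2 N and the n = 1 term vanishes (Λ(1) = 0)
    have hdrop : ∑ n ∈ Icc 2 (R / x), vonMangoldt n / n *
          (L / (s + Real.log n) ^ 2 + κ * L / (s + Real.log n) ^ 3) =
        ∑ n ∈ Icc 1 (R / x), vonMangoldt n / n * (L / (s + Real.log n) ^ 2) +
          ∑ n ∈ Icc 1 (R / x), vonMangoldt n / n * (κ * L / (s + Real.log n) ^ 3) := by
      have hI : Icc 1 (R / x) = insert 1 (Icc 2 (R / x)) := by
        ext n; simp only [Finset.mem_insert, Finset.mem_Icc]; omega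
      rw [hI, Finset.sum_insert (by simp), Finset.sum_insert (by simp)]
      simp only [ArithmeticFunction.vonMangoldt_apply_one, zero_div, zero_mul, zero_add]
      rw [← Finset.sum_add_distrib]
      exact Finset.sum_congr rfl fun n _ => by ring
    -- Step 3: y = s + log N ≤ L
    set y := s + Real.log ((R / x : ℕ) : ℝ) with hy
    have hN : y ≤ L := by
      have hprod : (x : ℝ) * ((R / x : ℕ) : ℝ) ≤ R := by exact_mod_cast Nat.mul_div_le R x
      have hNpos : (0 : ℝ) < ((R / x : ℕ) : ℝ) := by exact_mod_cast hRx
      rw [hy, hs, hLdef, ← Real.log_mul (by positivity) hNpos.ne']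
      exact Real.log_le_log (by positivity) hprod
    have hypos : 0 < y := by
      have := Real.log_natCast_nonneg (R / x); rw [hy]; linarith
    -- Step 4: the potential inequality
    --   1 + [(39/50)L/s² + L(1/s − 1/y)] + [(39/50)κL/s³ + (κL/2)(1/s² − 1/y²)] ≤ L/s + κL/s²
    have hkey : 1 + (39 / 50 * (L / s ^ 2) + L * (1 / s - 1 / y)) +
        (39 / 50 * (κ * L / s ^ 3) + κ * L / 2 * (1 / s ^ 2 - 1 / y ^ 2)) ≤ L / s + κ * L / s ^ 2 := by
      -- (a) 1 − L/y ≤ 0 and 0 ≤ κL/(2y²)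
      have ha : 1 - L / y ≤ 0 := by
        rw [sub_nonpos, le_div_iff₀ hypos]; linarith
      have ha' : 0 ≤ κ * L / 2 * (1 / y ^ 2) := by positivity
      -- (b) (39/50)(1 + κ/s) ≤ κ/2, from hQκ and s ≥ log(Q+1)
      have hb : 39 / 50 * (1 + κ / s) ≤ κ / 2 := by
        have h1 : κ / s ≤ κ / Real.log ((Q : ℝ) + 1) := div_le_div_of_nonneg_left hκ hlogQ1pos hlogQ1
        linarith
      -- (c) the s-terms are (L/s²)·[(39/50)(1 + κ/s) − κ/2] ≤ 0
      have hLs2 : 0 ≤ L / s ^ 2 := by positivity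
      have hc : 39 / 50 * (L / s ^ 2) + 39 / 50 * (κ * L / s ^ 3) + κ * L / 2 * (1 / s ^ 2) - κ * L / s ^ 2 =
          L / s ^ 2 * (39 / 50 * (1 + κ / s) - κ / 2) := by
        field_simp
        ring
      have hc' : 39 / 50 * (L / s ^ 2) + 39 / 50 * (κ * L / s ^ 3) + κ * L / 2 * (1 / s ^ 2) - κ * L / s ^ 2 ≤
          0 := by
        rw [hc]; exact mul_nonpos_of_nonneg_of_nonpos hLs2 (by linarith)
      have hexp : L * (1 / s - 1 / y) = L / s - L / y := by ring
      have hexp2 : κ * L / 2 * (1 / s ^ 2 - 1 / y ^ 2) = κ * L / 2 * (1 / s ^ 2) - κ * L / 2 * (1 / y ^ 2) := by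
        ring
      rw [hexp, hexp2]
      linarith [ha, ha', hc']
    calc 1 + ∑ n ∈ Icc 2 (R / x), vonMangoldt n / n * (exitGamma R Q (x * n) / Real.log ((x * n : ℕ) : ℝ))
        ≤ 1 + (∑ n ∈ Icc 1 (R / x), vonMangoldt n / n * (L / (s + Real.log n) ^ 2) +
            ∑ n ∈ Icc 1 (R / x), vonMangoldt n / n * (κ * L / (s + Real.log n) ^ 3)) := by
          rw [← hdrop]; linarith [hsum]
      _ ≤ 1 + (39 / 50 * (L / s ^ 2) + L * (1 / s - 1 / y)) +
            (39 / 50 * (κ * L / s ^ 3) + κ * L / 2 * (1 / s ^ 2 - 1 / y ^ 2)) := by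
          linarith [habel1, habel2]
      _ ≤ L / s + κ * L / s ^ 2 := hkey

/-- From `κ·L/s² ≤ (κ/ℓ₁)·L/s` for `0 < ℓ₁ ≤ s`, `0 ≤ κ`, `0 ≤ L` (the passage to the constant forms). -/
theorem mul_div_sq_le_div_mul_div {κ L s ℓ₁ : ℝ} (hκ : 0 ≤ κ) (hL : 0 ≤ L) (hℓ : 0 < ℓ₁) (hs : ℓ₁ ≤ s) :
    κ * L / s ^ 2 ≤ κ / ℓ₁ * L / s := by
  have hspos : 0 < s := hℓ.trans_le hs
  rw [div_le_div_iff₀ (by positivity) hspos]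
  have h1 : κ * L * s * ℓ₁ ≤ κ * L * s * s := mul_le_mul_of_nonneg_left hs (by positivity)
  calc κ * L * s = κ * L * s * ℓ₁ / ℓ₁ := by field_simp
    _ ≤ κ * L * s * s / ℓ₁ := div_le_div_of_nonneg_right h1 hℓ.le
    _ = κ / ℓ₁ * L * s ^ 2 := by
        field_simp

/-- **Constant form of `exitGamma_le_sharp`**: under the same hypotheses,
`Γ(x) ≤ (1 + κ/log(Q+1))·log R/log x` on the window (feed `A := 1 + κ/log(Q+1)` to THEOREM A's chain). -/
theorem exitGamma_le_sharp' {R Q : ℕ} (hQ : 1 ≤ Q) {κ : ℝ} (hκ : 0 ≤ κ)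
    (hQκ : 39 / 25 * (1 + κ / Real.log ((Q : ℝ) + 1)) ≤ κ) :
    ∀ x, Q < x → x ≤ R →
      exitGamma R Q x ≤ (1 + κ / Real.log ((Q : ℝ) + 1)) * Real.log R / Real.log x := by
  intro x hQx hxR
  have h := exitGamma_le_sharp hQ hκ hQκ x hQx hxR
  have hx2 : (2 : ℝ) ≤ x := by exact_mod_cast (show 2 ≤ x by omega)
  have hlogx : 0 < Real.log x := Real.log_pos (by linarith)
  have hlogQ1 : Real.log ((Q : ℝ) + 1) ≤ Real.log x :=
    Real.log_le_log (by positivity) (by exact_mod_cast hQx)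
  have hlogQ1pos : 0 < Real.log ((Q : ℝ) + 1) := Real.log_pos (by
    have : (1 : ℝ) ≤ Q := by exact_mod_cast hQ
    linarith)
  have hL : 0 ≤ Real.log R := by
    have hxR' : (x : ℝ) ≤ R := by exact_mod_cast hxR
    exact hlogx.le.trans (Real.log_le_log (by linarith) hxR')
  have h1 := mul_div_sq_le_div_mul_div hκ hL hlogQ1pos hlogQ1
  calc exitGamma R Q x ≤ Real.log R / Real.log x + κ * Real.log R / Real.log x ^ 2 := h
    _ ≤ Real.log R / Real.log x + κ / Real.log ((Q : ℝ) + 1) * Real.log R / Real.log x := by linarith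
    _ = (1 + κ / Real.log ((Q : ℝ) + 1)) * Real.log R / Real.log x := by ring

end Summit.RiemannHypothesis.RiemannHypothesis.Theorems.IntegerScrew

end
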